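import Summits.ResolutionOfSingularities.ResolutionOfSingularities.Theorems.PurelyInseparableDim4ResConeShearTransport
import Summits.ResolutionOfSingularities.ResolutionOfSingularities.Theorems.PurelyInseparableDim4Mode0UmbrellaSteps
import HarnessLib

/-!
# Purely inseparable four-folds — L-LIGHT KILL, part F3: AN ORDER-PRESERVING TWIN STEP FORCES THE LEADING MONOMIAL OF EVERY MINIMAL-DEGREE ROW
# (cell `res-dim4-pi`, K2(p) lane, the open loss-free `e = 3` cell; seat res-dim4-p-9 g6; HOME-only under desk R-251)

[OURS · counted 0]  Nothing here proves any TAIL(p, d, 3), K2(7), K2(p) or resolution of singularities in dimension ≥ 4 /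
characteristic `p` — NOT proved.  Coefficient algebra of OUR frame's point step on one `x_ν`-slice.  AI kernel work, weaker than expert review.

THE ROW LEMMA (memo `res-dim4-p-9/memo/L-LIGHT-KILL-g6.md` §4).  One `x_ν^v`-slice `G` (minimal degree `o ≥ p`, minimal `j`-exponent `≥ α_j`),
twin chart `j`, free letter `φ` sheared by `x_φ ↦ x_φ + t x_j`.  If the uncleaned child `G′ = chartTransform p univ j (shear j (t e_φ) G)` has
ORDER `≥ 2o − p − α_j` (i.e. the cofactor order `e = o − α_A − α_B − v` did NOT drop), then for every minimal-degree monomial `m0` of `G` the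
LEADING monomial of its row — same `i`- and `ν`-exponents, `j`-exponent `α_j`, `φ`-exponent `m0_j + m0_φ − α_j` — occurs in `G`
(`row_lead_mem_support`): the row's children below degree `2o − p − α_j` must cancel, a unitriangular system in the row's coefficients
whose only solution with vanishing leading coefficient is zero.  Two consecutive order-preserving steps with DIFFERENT twin charts therefore
put the monomial `x_A^{α_A} x_B^{α_B} x_ν^v x_φ^e` into the slice (`transition_corner_monomial`) — «`x_φ^e` enters the tangent cone of the cofactor».
[cite: Hauser2010, §§F–G, §I (P⁺)] [cite: HauserPerlega2019PRIMS, §2 (transform at a translated point)]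
[cite: CossartJannsenSaito2020, Lemma 13.2]
bears_on: LADDER-RESOLUTION:D157-DOOR2 (res-dim4-pi · K2(p) L-light cell · transition).  Supports stmt-ResolutionOfSingularities-16155 (helper).
-/

set_option linter.dupNamespace false -- mandated namespace of this single-conjunct summit

noncomputable section

namespace Summit.ResolutionOfSingularities.ResolutionOfSingularities.Theorems.PIDim4

namespace ResCone

namespace LLight

open MvPolynomial Finset
open Literature.AlgebraicGeometry.Resolution
open Literature.AlgebraicGeometry.Resolution.CentreBlowup
open Literature.AlgebraicGeometry.Resolution.Hauser2010

variable {K : Type} [Field K]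

/-- (tool, private copy of F1's) the coefficient of a chart image. -/
private theorem coeff_cT_chartExponent₃ {Q : ℕ} {j : Fin 4} {P : MvPolynomial (Fin 4) K}
    (hP : ∀ d ∈ P.support, Q ≤ d.degree) {e : Fin 4 →₀ ℕ} (he : Q ≤ e.degree) :
    coeff (chartExponent Q Finset.univ j e) (chartTransform Q Finset.univ j P) = coeff e P := by
  classical
  by_cases hes : e ∈ P.support
  · exact Mode0Umbrella.coeff_chartTransform_univ hP hes
  · rw [MvPolynomial.notMem_support_iff.mp hes]
    by_contra hne
    obtain ⟨d, hd, hde⟩ := Mode0Umbrella.exists_of_mem_support_chartTransform (MvPolynomial.mem_support_iff.mpr hne)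
    exact hes (Mode0Umbrella.chartExponent_univ_inj (hP d hd) he hde ▸ hd)

/-! ## 1. A unitriangular system -/

/-- **Unitriangular back-substitution**: if `c_g = 0` for `f₀ ≤ g ≤ s` and `Σ_{l ≤ s − f} C(f + l, l) t^l c_{f+l} = 0` for every `f < f₀`,
then `c_g = 0` for every `g ≤ s`. [folklore] -/
theorem eq_zero_of_unitriangular {c : ℕ → K} {t : K} {f₀ s : ℕ} (htop : ∀ g, f₀ ≤ g → g ≤ s → c g = 0)
    (heq : ∀ f, f < f₀ → ∑ l ∈ Finset.range (s - f + 1), ((f + l).choose l : K) * t ^ l * c (f + l) = 0) :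
    ∀ g, g ≤ s → c g = 0 := by
  suffices H : ∀ n g, f₀ - n ≤ g → g ≤ s → c g = 0 from fun g hg => H f₀ g (by omega) hg
  intro n
  induction n with
  | zero => intro g hg hgs; exact htop g (by omega) hgs
  | succ n ih =>
    intro g hg hgs
    by_cases hgf : f₀ ≤ g
    · exact htop g hgf hgs
    · have h := heq g (by omega)
      rw [Finset.sum_range_succ'] at h
      have htail : ∑ l ∈ Finset.range (s - g), ((g + (l + 1)).choose (l + 1) : K) * t ^ (l + 1) * c (g + (l + 1)) = 0 :=
        Finset.sum_eq_zero fun l hl => by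
          rw [ih (g + (l + 1)) (by omega) (by have := Finset.mem_range.mp hl; omega), mul_zero]
      rw [htail, zero_add, add_zero, Nat.choose_zero_right, Nat.cast_one, pow_zero, one_mul, one_mul] at h
      exact h

/-! ## 2. The row lemma -/

section Row

variable {p : ℕ} {j φ : Fin 4} {G : MvPolynomial (Fin 4) K} {t : K} {o αj : ℕ}

/-- The exponents of the row of `m0` indexed by the `φ`-exponent `g`: `E g = m0[j ↦ s − g, φ ↦ g]`, `s = m0_j + m0_φ`. -/
theorem rowExp_apply (hjφ : j ≠ φ) (m0 : Fin 4 →₀ ℕ) (g : ℕ) (i : Fin 4) :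
    ((m0.update j (m0 j + m0 φ - g)).update φ g) i = if i = φ then g else if i = j then m0 j + m0 φ - g else m0 i := by
  rw [Finsupp.coe_update, Finsupp.coe_update]
  by_cases hiφ : i = φ
  · subst hiφ; rw [Function.update_self, if_pos rfl]
  · rw [Function.update_of_ne hiφ, if_neg hiφ]
    by_cases hij : i = j
    · subst hij; rw [Function.update_self, if_pos rfl]
    · rw [Function.update_of_ne hij, if_neg hij]

/-- The row exponent at `g = m0_φ` is `m0` itself. -/
theorem rowExp_self (hjφ : j ≠ φ) (m0 : Fin 4 →₀ ℕ) : (m0.update j (m0 j + m0 φ - m0 φ)).update φ (m0 φ) = m0 := by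
  ext i; rw [rowExp_apply hjφ]; split_ifs with h1 h2
  · rw [h1]
  · rw [h2]; omega
  · rfl

/-- Degree of a row exponent (`g ≤ s`). -/
theorem degree_rowExp (hjφ : j ≠ φ) (m0 : Fin 4 →₀ ℕ) {g : ℕ} (hg : g ≤ m0 j + m0 φ) :
    ((m0.update j (m0 j + m0 φ - g)).update φ g).degree = m0.degree := by
  have h1 := PointBlowup.degree_update_add (m0.update j (m0 j + m0 φ - g)) φ g
  have h2 := PointBlowup.degree_update_add m0 j (m0 j + m0 φ - g)
  rw [Finsupp.coe_update, Function.update_of_ne hjφ.symm] at h1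
  omega

/-- The shear source of a row exponent is the row exponent further up: `(E f)[j ↦ (E f)_j − l, φ ↦ (E f)_φ + l] = E (f + l)`. -/
theorem rowExp_shearSource (hjφ : j ≠ φ) (m0 : Fin 4 →₀ ℕ) (s f l : ℕ) :
    (((m0.update j (s - f)).update φ f).update j (s - f - l)).update φ (f + l) =
      (m0.update j (s - (f + l))).update φ (f + l) := by
  ext i
  simp only [Finsupp.coe_update, Function.update_apply]
  by_cases hiφ : i = φ
  · subst hiφ; simp
  · by_cases hij : i = j
    · subst hij; simp [hiφ]; omega
    · simp [hiφ, hij]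

/-- **THE ROW LEMMA**: an order-preserving twin step (`G′` has order `≥ 2o − p − α_j`) forces, for every minimal-degree monomial `m0` of the
slice, the LEADING monomial of its row `m0[j ↦ α_j, φ ↦ m0_j + m0_φ − α_j]` to occur in `G`. [OURS · memo L-LIGHT-KILL-g6 §4]
[cite: Hauser2010, §I (P⁺)] [cite: CossartJannsenSaito2020, Lemma 13.2] -/
theorem row_lead_mem_support (hjφ : j ≠ φ) (ho : ∀ d ∈ G.support, o ≤ d.degree) (hαj : ∀ d ∈ G.support, αj ≤ d j) (hpo : p ≤ o)
    (hpres : ∀ d' ∈ (chartTransform p Finset.univ j (Hauser2010.shear j (Pi.single φ t) G)).support, 2 * o ≤ d'.degree + p + αj)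
    {m0 : Fin 4 →₀ ℕ} (hm0 : m0 ∈ G.support) (hm0o : m0.degree = o) :
    (m0.update j αj).update φ (m0 j + m0 φ - αj) ∈ G.support := by
  classical
  set s : ℕ := m0 j + m0 φ with hs
  have hαjs : αj ≤ m0 j := hαj m0 hm0
  -- the row coefficients
  set c : ℕ → K := fun g => coeff ((m0.update j (s - g)).update φ g) G with hc
  by_contra habs
  -- (a) coefficients at and above the leading index vanish
  have htop : ∀ g, s - αj ≤ g → g ≤ s → c g = 0 := by
    intro g hg hgs
    rcases Nat.eq_or_lt_of_le hg with hge | hgt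
    · -- the leading monomial itself: absent by assumption
      rw [hc]
      simp only
      have hexp : (m0.update j (s - g)).update φ g = (m0.update j αj).update φ (m0 j + m0 φ - αj) := by
        rw [← hge, show s - (s - αj) = αj by omega]
      rw [hexp]
      exact MvPolynomial.notMem_support_iff.mp habs
    · -- `j`-exponent `s − g < α_j`
      rw [hc]
      by_contra hne
      have h := hαj _ (MvPolynomial.mem_support_iff.mpr hne)
      rw [rowExp_apply hjφ, if_neg hjφ, if_pos rfl] at h
      omega
  -- degrees in the sheared support are `≥ p`
  have hdegs : ∀ d ∈ (Hauser2010.shear j (Pi.single φ t) G).support, p ≤ d.degree := by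
    intro d hd
    obtain ⟨m', hm', l, hl, rfl⟩ := exists_of_mem_support_shear_single hjφ t G hd
    have h1 := PointBlowup.degree_update_add (m'.update φ (m' φ - l)) j (m' j + l)
    have h2 := PointBlowup.degree_update_add m' φ (m' φ - l)
    rw [Finsupp.coe_update, Function.update_of_ne hjφ] at h1
    have := ho m' hm'
    omega
  -- (b) the equations: children below the new order cancel
  have heq : ∀ f, f < s - αj → ∑ l ∈ Finset.range (s - f + 1), ((f + l).choose l : K) * t ^ l * c (f + l) = 0 := by
    intro f hf
    set E : Fin 4 →₀ ℕ := (m0.update j (s - f)).update φ f with hE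
    have hEdeg : E.degree = o := by rw [hE, degree_rowExp hjφ m0 (by omega), hm0o]
    have hEj : E j = s - f := by rw [hE, rowExp_apply hjφ, if_neg hjφ, if_pos rfl]
    have hEφ : E φ = f := by rw [hE, rowExp_apply hjφ, if_pos rfl]
    -- the child exponent is absent from `G′`
    have hchild : coeff (chartExponent p Finset.univ j E) (chartTransform p Finset.univ j (Hauser2010.shear j (Pi.single φ t) G)) = 0 := by
      by_contra hne
      have h := hpres _ (MvPolynomial.mem_support_iff.mpr hne)
      have hd := degree_chartExponent_univ p j (e := E) (by rw [hEdeg]; exact hpo)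
      rw [hEdeg, hEj] at hd
      omega
    rw [coeff_cT_chartExponent₃ hdegs (by rw [hEdeg]; exact hpo), coeff_shear_single hjφ, hEj, hEφ] at hchild
    rw [← hchild]
    refine Finset.sum_congr rfl fun l _ => ?_
    rw [rowExp_shearSource hjφ]
  -- (c) back-substitution kills the whole row, including `m0`
  have hzero := eq_zero_of_unitriangular htop heq (m0 φ) (by omega)
  rw [hc] at hzero
  simp only at hzero
  rw [show s - m0 φ = m0 j + m0 φ - m0 φ by rw [hs], rowExp_self hjφ] at hzero
  exact (MvPolynomial.mem_support_iff.mp hm0) hzero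

end Row

end LLight

end ResCone

end Summit.ResolutionOfSingularities.ResolutionOfSingularities.Theorems.PIDim4

end
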